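import Mathlib
import Summits.Ventures.PercRepro2.HCov
import Summits.Ventures.PercRepro2.HCovSwap
import Summits.Ventures.PercRepro2.RECMReduction
import Summits.Ventures.PercRepro2.LeafMarkAny

/-!
# An isolated mark among `a₁, a₂, o, b`: `Gc = 0`, and the leaf reduction as «degree ≥ 2»
(blind cell PercRepro2, p5 g24; `proofs/P5-OEDGE.md` §30 addendum 5)

A mark `x` is ISOLATED when every edge at `x` is a loop (`IsIsolated`); then `x` is connected to
nothing but itself (`conn_isolated`, by the closure lemma `mem_of_conn_of_closed` with `S = {x}`).

* `o` isolated: every `o`-mass of `Gc` vanishes — **`Gc_isolated_o`**;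
* `b` isolated: every `b`-mass and the gap vanish — **`Gc_isolated_b`**;
* a root isolated: `Q = univ`, `T = ∅`, `PD ⊔ T′ = univ`, `C₂ = {a₂}` — the eleven masses collapse on the
  `a₂`-free masses and **`Gc_isolated_root`** `= 0` (the (HCOV) form of «`G ≡ 0` when one cluster is
  trivial», P5-OEDGE §27); the mirror at `a₁` by `Gc_swap`.

Hence **`HCov_isolated_mark`**: (HCOV) outright when one of `a₁, a₂, o, b` is isolated, and the class of
the leaf reduction tightens to **`DegGeTwo`** — each of `a₁, a₂, o, b` has an edge to another vertex
and is not a leaf — with **`HCov_all_of_degGeTwo : HCovDeg2_all → HCov_all`**: a minimal counterexample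
to (HCOV) has each of `a₁, a₂, o, b` of degree ≥ 2.
-/

namespace Summit.Ventures.PercRepro2

open CovForm RECM LeafMarkAny UnionCluster

namespace IsolatedMark

section Conn

variable {V : Type*} {E : Type*}

/-- `x` is isolated: every edge at `x` is a loop. -/
def IsIsolated (ends : E → Sym2 V) (x : V) : Prop := ∀ e, x ∈ ends e → (ends e).IsDiag

/-- An isolated vertex is connected to nothing but itself. -/
lemma conn_isolated {ends : E → Sym2 V} {x : V} (hx : IsIsolated ends x) (ω : Config E) {y : V}
    (h : Conn ends ω x y) : y = x := by
  have hS : ∀ u ∈ ({x} : Set V), ∀ z, (openGraph ends ω).Adj u z → z ∈ ({x} : Set V) := by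
    intro u hu z hadj
    rw [Set.mem_singleton_iff] at hu
    subst hu
    rw [openGraph_adj] at hadj
    obtain ⟨hne, e, -, he⟩ := hadj
    exfalso
    have hmem : u ∈ ends e := by rw [he]; exact Sym2.mem_mk_left u z
    have hd := hx e hmem
    rw [he] at hd
    exact hne (Sym2.mk_isDiag_iff.mp hd)
  exact Set.mem_singleton_iff.mp (mem_of_conn_of_closed hS (Set.mem_singleton x) h)

/-- The connection events of an isolated vertex with a different vertex are empty. -/
lemma connEvent_isolated {ends : E → Sym2 V} {x y : V} (hx : IsIsolated ends x) (hxy : x ≠ y) :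
    connEvent ends x y = ∅ := by
  ext ω
  simp only [mem_connEvent, Set.mem_empty_iff_false, iff_false]
  exact fun h => hxy (conn_isolated hx ω h).symm

/-- The connection events of a different vertex with an isolated vertex are empty. -/
lemma connEvent_isolated' {ends : E → Sym2 V} {x y : V} (hx : IsIsolated ends x) (hxy : x ≠ y) :
    connEvent ends y x = ∅ := by
  ext ω
  simp only [mem_connEvent, Set.mem_empty_iff_false, iff_false]
  exact fun h => hxy (conn_isolated hx ω (conn_symm h)).symm

end Conn

section Zero

variable {V : Type*} {E : Type*} [Fintype E] [DecidableEq E] [DecidableEq V]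
  {R : Type*} [Field R] [LinearOrder R] [IsStrictOrderedRing R]

omit [DecidableEq V] [LinearOrder R] [IsStrictOrderedRing R] in
/-- **`o` isolated: `Gc = 0`** (every `o`-mass vanishes). -/
theorem Gc_isolated_o (p : E → R) {ends : E → Sym2 V} {o : V} (ho : IsIsolated ends o)
    {a₁ a₂ a₃ b : V} (ho1 : o ≠ a₁) (ho2 : o ≠ a₂) :
    Gc p ends o a₁ a₂ a₃ b = 0 := by
  have e1 : connEvent ends a₁ o = ∅ := connEvent_isolated' ho ho1
  have e2 : connEvent ends a₂ o = ∅ := connEvent_isolated' ho ho2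
  unfold Gc DEF EQbo EQb3o EQo EQ3o PDbo Do
  simp only [e1, e2, Set.inter_empty, Set.empty_inter, prob_empty]
  ring

omit [DecidableEq V] [LinearOrder R] [IsStrictOrderedRing R] in
/-- **`b` isolated: `Gc = 0`** (every `b`-mass and the gap vanish). -/
theorem Gc_isolated_b (p : E → R) {ends : E → Sym2 V} {b : V} (hb : IsIsolated ends b)
    {o a₁ a₂ a₃ : V} (hb1 : b ≠ a₁) (hb2 : b ≠ a₂) :
    Gc p ends o a₁ a₂ a₃ b = 0 := by
  have e1 : connEvent ends a₁ b = ∅ := connEvent_isolated' hb hb1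
  have e2 : connEvent ends a₂ b = ∅ := connEvent_isolated' hb hb2
  unfold Gc DEF EQbo EQb3 EQb3o PDb PDbo gap
  simp only [e1, e2, Set.inter_empty, prob_empty]
  ring

omit [DecidableEq V] [LinearOrder R] [IsStrictOrderedRing R] in
/-- The `a₂`-free masses of an instance whose root `a₂` is isolated: `Q = univ`, `T = ∅`, every
`{· ∈ C₂}` event of another vertex is empty, and `PD ⊔ T′ = univ`. -/
theorem Gc_isolated_root (p : E → R) {ends : E → Sym2 V} {a₂ : V} (h2 : IsIsolated ends a₂)
    {o a₁ a₃ b : V} (h12 : a₁ ≠ a₂) (h32 : a₃ ≠ a₂) (ho2 : o ≠ a₂) (hb2 : b ≠ a₂) :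
    Gc p ends o a₁ a₂ a₃ b = 0 := by
  have eQ : avoidAll ends a₂ {a₁} = Set.univ := by
    ext ω
    simp only [avoidAll, Set.mem_setOf_eq, Finset.mem_singleton, forall_eq, Set.mem_univ, iff_true]
    exact fun h => h12 (conn_isolated h2 ω h)
  have eo : connEvent ends a₂ o = ∅ := connEvent_isolated h2 ho2.symm
  have eb : connEvent ends a₂ b = ∅ := connEvent_isolated h2 hb2.symm
  have e3 : connEvent ends a₂ a₃ = ∅ := connEvent_isolated h2 h32.symm
  have eT : TEvent ends a₁ a₂ a₃ = ∅ := by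
    unfold TEvent
    rw [e3, Set.inter_empty]
  -- `PD = {a₃ ∉ C₁}` and `T′ = {a₃ ∈ C₁}` partition the space
  have ePD : PDEvent ends a₁ a₂ a₃ = (connEvent ends a₃ a₁)ᶜ := by
    unfold PDEvent Dtilde UnionCluster.inU
    have : connEvent ends a₃ a₂ = ∅ := connEvent_isolated' h2 h32.symm
    rw [this, Set.union_empty]
    have hQ : (connEvent ends a₁ a₂)ᶜ = Set.univ := by
      ext ω
      simp only [Set.mem_compl_iff, mem_connEvent, Set.mem_univ, iff_true]
      exact fun h => h12 (conn_isolated h2 ω (conn_symm h))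
    rw [hQ, Set.univ_inter]
  have eTp : TEvent ends a₂ a₁ a₃ = connEvent ends a₁ a₃ := by
    unfold TEvent
    have hQ : (connEvent ends a₁ a₂)ᶜ = Set.univ := by
      ext ω
      simp only [Set.mem_compl_iff, mem_connEvent, Set.mem_univ, iff_true]
      exact fun h => h12 (conn_isolated h2 ω (conn_symm h))
    rw [hQ, Set.univ_inter]
  have e31 : connEvent ends a₃ a₁ = connEvent ends a₁ a₃ := by
    ext ω; simp only [mem_connEvent]; exact ⟨conn_symm, conn_symm⟩
  -- the masses: `P(X) = P(PD ∩ X) + P(T′ ∩ X)` for every `X`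
  have split : ∀ X : Set (Config E), prob p X =
      prob p (PDEvent ends a₁ a₂ a₃ ∩ X) + prob p (TEvent ends a₂ a₁ a₃ ∩ X) := by
    intro X
    have h := prob_inter_add_prob_inter_compl p X (connEvent ends a₁ a₃)
    have e1 : PDEvent ends a₁ a₂ a₃ ∩ X = X ∩ (connEvent ends a₁ a₃)ᶜ := by
      rw [ePD, e31, Set.inter_comm]
    have e2 : TEvent ends a₂ a₁ a₃ ∩ X = X ∩ connEvent ends a₁ a₃ := by
      rw [eTp, Set.inter_comm]
    rw [e1, e2]
    linear_combination -h
  have hD : prob p (PDEvent ends a₁ a₂ a₃) = 1 - prob p (TEvent ends a₂ a₁ a₃) := by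
    have := split Set.univ
    rw [Set.inter_univ, Set.inter_univ, prob_univ] at this
    linear_combination -this
  unfold Gc DEF EQbo EQb3 EQb3o EQo EQ3 EQ3o PDb PDbo Do gap
  rw [eQ, eT]
  simp only [eo, eb, Set.inter_empty, Set.empty_inter, prob_empty, Set.univ_inter, prob_univ]
  rw [split (connEvent ends a₁ o ∩ connEvent ends a₁ b), split (connEvent ends a₁ o),
    split (connEvent ends a₁ b), hD]
  ring

end Zero

section Outright

variable {V : Type*} {E : Type*} [Fintype E] [DecidableEq E] [DecidableEq V]
  {R : Type*} [Field R] [LinearOrder R] [IsStrictOrderedRing R]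

omit [DecidableEq V] [IsStrictOrderedRing R] in
/-- **(HCOV) outright when one of `a₁, a₂, o, b` is isolated.** -/
theorem HCov_isolated_mark (p : E → R) {ends : E → Sym2 V} {o a₁ a₂ a₃ b : V} (h12 : a₁ ≠ a₂)
    (h13 : a₁ ≠ a₃) (h23 : a₂ ≠ a₃) (ho1 : o ≠ a₁) (ho2 : o ≠ a₂) (hb1 : b ≠ a₁) (hb2 : b ≠ a₂)
    (h : IsIsolated ends a₁ ∨ IsIsolated ends a₂ ∨ IsIsolated ends o ∨ IsIsolated ends b) :
    HCov p ends o a₁ a₂ a₃ b := by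
  unfold HCov
  rcases h with h | h | h | h
  · rw [← Gc_swap, Gc_isolated_root p h h12.symm h13.symm ho1 hb1]
  · rw [Gc_isolated_root p h h12 h23.symm ho2 hb2]
  · rw [Gc_isolated_o p h ho1 ho2]
  · rw [Gc_isolated_b p h hb1 hb2]

end Outright

section Classes

variable {V : Type*} {E : Type*} [DecidableEq V]

/-- **The class `DegGeTwo`**: each of `a₁, a₂, o, b` has an edge to another vertex and is not a leaf
(so has degree ≥ 2 in the multigraph without its loops). -/
def DegGeTwo (ends : E → Sym2 V) (o a₁ a₂ b : V) : Prop :=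
  (¬ IsIsolated ends a₁ ∧ ¬ IsIsolated ends a₂ ∧ ¬ IsIsolated ends o ∧ ¬ IsIsolated ends b) ∧
    NoLeafMark ends o a₁ a₂ b

end Classes

section Closure

variable (R : Type*) [Field R] [LinearOrder R] [IsStrictOrderedRing R]

/-- **(HCOV) on the class `DegGeTwo`**. -/
def HCovDeg2_all : Prop :=
  ∀ (V E : Type) [Fintype V] [DecidableEq V] [Fintype E] [DecidableEq E]
    (ends : E → Sym2 V) (p : E → R), IsProbVec p →
    ∀ o a₁ a₂ a₃ b : V, a₁ ≠ a₂ → a₁ ≠ a₃ → a₂ ≠ a₃ → o ≠ a₁ → o ≠ a₂ → o ≠ a₃ → o ≠ b →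
      b ≠ a₁ → b ≠ a₂ → b ≠ a₃ → DegGeTwo ends o a₁ a₂ b → HCov p ends o a₁ a₂ a₃ b

end Closure

section Main

variable {R : Type*} [Field R] [LinearOrder R] [IsStrictOrderedRing R]

omit [IsStrictOrderedRing R] in
/-- (HCOV) on `NoLeafMark` from (HCOV) on `DegGeTwo`: an isolated mark is (HCOV) outright. -/
theorem HCovNLM_all_of_HCovDeg2_all (hB : HCovDeg2_all R) : HCovNLM_all R := by
  intro V E _ _ _ _ ends p hp o a₁ a₂ a₃ b h12 h13 h23 ho1 ho2 ho3 hob hb1 hb2 hb3 hNL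
  by_cases hiso : IsIsolated ends a₁ ∨ IsIsolated ends a₂ ∨ IsIsolated ends o ∨ IsIsolated ends b
  · exact HCov_isolated_mark p h12 h13 h23 ho1 ho2 hb1 hb2 hiso
  · push Not at hiso
    exact hB V E ends p hp o a₁ a₂ a₃ b h12 h13 h23 ho1 ho2 ho3 hob hb1 hb2 hb3 ⟨hiso, hNL⟩

/-- **THE LEAF REDUCTION OF (HCOV) AS «DEGREE ≥ 2»**: `HCovDeg2_all → HCov_all` — (HCOV) for every finite
weighted graph follows from (HCOV) on the graphs in which each of `a₁, a₂, o, b` has degree ≥ 2. -/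
theorem HCov_all_of_degGeTwo (hB : HCovDeg2_all R) : HCov_all R :=
  HCov_all_of_noLeafMark (HCovNLM_all_of_HCovDeg2_all hB)

end Main

end IsolatedMark

end Summit.Ventures.PercRepro2
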